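import Summits.RiemannHypothesis.RiemannHypothesis.Theorems.LiTailLaguerreStrip
import Summits.RiemannHypothesis.RiemannHypothesis.Theorems.LiTailLaguerreBridgeCoffey
import Literature.Analysis.Fourier.VanDerCorput
import HarnessLib

/-!
# RiemannHypothesis / LiTailLaguerre — crux K2′ `LiPrimeTailLaguerre`, part 3: a RELEASED prime power gives exactly its
# Coffey–Laguerre term (RH-FREE)

RH-FREE [rh-li-prover g5].  Route `Theses/LiTailLaguerre.lean` (round 7, leaf `LiTheory.LiZeroTailLaguerre`), item
`LiPrimeTailLaguerre` (stmt-RiemannHypothesis-19702, DECIDING).  After the Cauchy shift of part 2, the `m`-term of the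
prime tail is `∫_{Ioi T} m^{−(1/2+it)} (2 − k_n(½ + it)) dt + i·(connector)`.  On the critical line
`2 − k_n(½ + it) = 2(1 − cos nθ(t))` is REAL (`GammaShift.liSymWeight_half_line`), so the real part of the line integral is
`m^{−1/2} ∫_T^∞ (2 − 2cos nθ(t)) cos(t log m) dt = m^{−1/2} [∫_0^∞ − ∫_0^T]`.  The complete integral is the tree's
LAGUERRE BRIDGE `Literature.Analysis.SpecialFunctions.integral_liKernel_mul_cos_Ioi` (Coffey 2010 (122) in Fourier-dual
form, in the column's notation tail-p2 g2's `PrimeTail.integral_bridge_eq`): `∫_0^∞ 2(1 − cos nθ) cos(ty) dt =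
π e^{−y/2} liLaguerreOne n y`; with `y = log m` this is `π m^{−1/2}·L¹_{n−1}(log m)`, i.e. the term contributes `(π/m) L¹_{n−1}(log m)` =
`π · liCoffeyTerm m n / Λ(m)`.  The piece `∫_0^T` is NON-STATIONARY when `m` is released
(`log m ≤ n/(T² + ¼) − Gap`): writing `(2 − 2cos nθ) cos(ty) = 2cos(ty) − cos(nϑ + ty) − cos(nϑ − ty)` with the smooth
branch `ϑ(t) = π − 2 arctan 2t` (`= θ(t)` for `t > 0`), both phases have derivative `≤ −Gap`, resp. `≤ −log m`, and
convex second derivative, so the tree's first-derivative test `Literature.Analysis.Fourier.norm_integral_exp_I_mul_le_of_deriv_le`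
bounds it by `4/log m + 2/Gap`.  RESULT (`re_setIntegral_termIntegrand_released`):
`|Re ∫_{Ioi T} m^{−w}(2 − k_n) dy − (π/m) L¹_{n−1}(log m)| ≤ m^{−1/2}(4/log m + 2/Gap + 3 + e^{n/T²})`.
Nothing here bears on the truth of RH.
-/

noncomputable section

-- D-0017: `Summit.<S>.<S>.…` is the designed namespace of a single-problem summit.
set_option linter.dupNamespace false

open Complex MeasureTheory intervalIntegral Set Filter
open scoped Real Interval Topology ArithmeticFunction.vonMangoldt

namespace Summit.RiemannHypothesis.RiemannHypothesis.Theorems.LiTheory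

open Literature.NumberTheory.LFunctions

namespace PrimeTail

open PrimeEdge TailContour GammaShift

/-! ### The critical line: real part of `G(½ + it)` -/

/-- `Re m^{−(1/2 + it)} = m^{−1/2} cos(t log m)` (`m ≥ 1`). -/
theorem re_cpow_neg_half {m : ℕ} (hm : 0 < m) (t : ℝ) :
    ((m : ℂ) ^ (-(1 / 2 + t * I))).re = (m : ℝ) ^ (-(1 / 2 : ℝ)) * Real.cos (t * Real.log m) := by
  have hm' : (m : ℂ) ≠ 0 := by exact_mod_cast hm.ne'
  rw [Complex.cpow_def_of_ne_zero hm', ← Complex.natCast_log, Complex.exp_re]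
  have hre : ((Real.log m : ℂ) * -(1 / 2 + t * I)).re = Real.log m * (-(1 / 2 : ℝ)) := by
    rw [Complex.re_ofReal_mul]; congr 1; simp
  have him : ((Real.log m : ℂ) * -(1 / 2 + t * I)).im = -(t * Real.log m) := by
    rw [Complex.im_ofReal_mul]
    have : (-(1 / 2 + (t : ℂ) * I)).im = -t := by simp
    rw [this]; ring
  rw [hre, him, Real.cos_neg, Real.rpow_def_of_pos (by exact_mod_cast hm)]

/-- `Re G(½ + it) = m^{−1/2} · 2(1 − cos nθ(t)) cos(t log m)` (`t ≠ 0`; `2 − k_n(½ + it) = 2 f_n(t)` is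
`GammaTail.liCoSymWeight_half_line`). -/
theorem re_G_half {n m : ℕ} (hm : 0 < m) {t : ℝ} (ht : t ≠ 0) :
    (G n m (1 / 2 + t * I)).re =
      (m : ℝ) ^ (-(1 / 2 : ℝ)) * (2 * (1 - Real.cos (n * liZeroAngle t)) * Real.cos (t * Real.log m)) := by
  rw [G, GammaTail.liCoSymWeight_half_line n ht, Complex.re_mul_ofReal, re_cpow_neg_half hm, liWindowWeight]
  ring

/-- `Re ∫_{Ioi T} G(½ + it) dt = m^{−1/2} ∫_{Ioi T} 2(1 − cos nθ(t)) cos(t log m) dt` (`T ≥ 0`, `m ≥ 1`). -/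
theorem re_setIntegral_G_half {n m : ℕ} (hm : 0 < m) {T : ℝ} (hT : 0 ≤ T) :
    (∫ t in Ioi T, G n m (1 / 2 + t * I)).re =
      (m : ℝ) ^ (-(1 / 2 : ℝ)) * ∫ t in Ioi T, 2 * (1 - Real.cos (n * liZeroAngle t)) * Real.cos (t * Real.log m) := by
  have hint : Integrable (fun t : ℝ ↦ G n m (1 / 2 + t * I)) (volume.restrict (Ioi T)) :=
    (integrable_G_half n hm).restrict
  have hcomm := ContinuousLinearMap.integral_comp_comm Complex.reCLM hint
  simp only [Complex.reCLM_apply] at hcomm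
  rw [← hcomm, ← MeasureTheory.integral_const_mul]
  refine setIntegral_congr_fun measurableSet_Ioi fun t ht ↦ ?_
  exact re_G_half hm (ne_of_gt (hT.trans_lt ht))

/-! ### The non-stationary piece `∫_0^T` -/

/-- `∫_0^T 2cos(ty) dt` is bounded by `2/y` (`y > 0`). -/
theorem abs_integral_two_cos_le (T : ℝ) {y : ℝ} (hy : 0 < y) :
    |∫ t in (0 : ℝ)..T, 2 * Real.cos (t * y)| ≤ 2 / y := by
  have hderiv : ∀ t ∈ uIcc 0 T, HasDerivAt (fun t : ℝ ↦ 2 * Real.sin (t * y) / y) (2 * Real.cos (t * y)) t := by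
    intro t _
    have h := ((Real.hasDerivAt_sin (t * y)).comp t ((hasDerivAt_id t).mul_const y)).const_mul 2 |>.div_const y
    refine h.congr_deriv ?_
    field_simp
  rw [integral_eq_sub_of_hasDerivAt hderiv
    ((by fun_prop : Continuous fun t : ℝ ↦ 2 * Real.cos (t * y)).intervalIntegrable _ _)]
  simp only [zero_mul, Real.sin_zero, mul_zero, zero_div, sub_zero]
  rw [abs_div, abs_of_pos hy]
  refine div_le_div_of_nonneg_right ?_ hy.le
  have := Real.abs_sin_le_one (T * y)
  rw [abs_mul, abs_two]
  nlinarith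

/-- The smooth branch of the zero angle: `ϑ(t) = π − 2 arctan 2t` (`= liZeroAngle t` for `t > 0`). -/
theorem liZeroAngle_eq_pi_sub {t : ℝ} (ht : 0 < t) : liZeroAngle t = π - 2 * Real.arctan (2 * t) := by
  unfold liZeroAngle
  rw [one_div, Real.arctan_inv_of_pos (by positivity)]
  ring

/-- First-derivative test for the phases `nϑ(t) + s·t y` (`s = ±1`): if `y > 0`, `0 ≤ T`, `0 < lam` and
`−4n/(1 + 4t²) + s y ≤ −lam` on `[0, T]`, then `‖∫_0^T e^{i(nϑ + s t y)}‖ ≤ 2/lam`. -/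
theorem norm_integral_phase_le (n : ℕ) {T y s lam : ℝ} (hT : 0 ≤ T) (hlam : 0 < lam)
    (hle : ∀ t ∈ Icc 0 T, -(4 * n / (1 + 4 * t ^ 2)) + s * y ≤ -lam) :
    ‖∫ t in (0 : ℝ)..T, Complex.exp (I * ((n * (π - 2 * Real.arctan (2 * t)) + s * (t * y) : ℝ) : ℂ))‖ ≤ 2 / lam := by
  -- phase, first and second derivative
  set φ : ℝ → ℝ := fun t ↦ n * (π - 2 * Real.arctan (2 * t)) + s * (t * y) with hφ
  set φ' : ℝ → ℝ := fun t ↦ -(4 * n / (1 + 4 * t ^ 2)) + s * y with hφ'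
  set φ'' : ℝ → ℝ := fun t ↦ 32 * n * t / (1 + 4 * t ^ 2) ^ 2 with hφ''
  have hpos : ∀ t : ℝ, 0 < 1 + 4 * t ^ 2 := fun t ↦ by positivity
  have hd1 : ∀ t : ℝ, HasDerivAt φ (φ' t) t := by
    intro t
    have ha : HasDerivAt (fun t : ℝ ↦ Real.arctan (2 * t)) (1 / (1 + (2 * t) ^ 2) * 2) t :=
      (Real.hasDerivAt_arctan (2 * t)).comp t ((hasDerivAt_id t).const_mul 2 |>.congr_deriv (by simp))
    have h := ((ha.const_mul 2).const_sub π).const_mul (n : ℝ) |>.add (((hasDerivAt_id t).mul_const y).const_mul s)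
    refine h.congr_deriv ?_
    simp only [hφ']
    field_simp
    ring
  have hd2 : ∀ t : ℝ, HasDerivAt φ' (φ'' t) t := by
    intro t
    have hq : HasDerivAt (fun t : ℝ ↦ 1 + 4 * t ^ 2) (4 * (2 * t)) t := by
      have := ((hasDerivAt_pow 2 t).const_mul 4).const_add 1
      simpa using this
    have h := (((hasDerivAt_const t (4 * (n : ℝ))).div hq (hpos t).ne').neg).add_const (s * y)
    refine h.congr_deriv ?_
    simp only [hφ'']
    field_simp
    ring
  have hcont : ContinuousOn φ'' (Icc 0 T) := by
    simp only [hφ'']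
    exact (Continuous.continuousOn (by fun_prop))
      |>.div (Continuous.continuousOn (by fun_prop)) fun t _ ↦ pow_ne_zero _ (hpos t).ne'
  have hsign : (∀ t ∈ Icc 0 T, 0 ≤ φ'' t) ∨ (∀ t ∈ Icc 0 T, φ'' t ≤ 0) :=
    Or.inl fun t ht ↦ by simp only [hφ'']; exact div_nonneg (by have := ht.1; positivity) (by positivity)
  have h := Literature.Analysis.Fourier.norm_integral_exp_I_mul_le_of_deriv_le (φ := φ) (φ' := φ') (φ'' := φ'')
    hT hlam (fun t _ ↦ hd1 t) (fun t _ ↦ hd2 t) hcont hsign (fun t ht ↦ hle t ht)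
  simpa [hφ] using h

/-- **The `[0, T]` piece is non-stationary for a released `m`**: if `0 < y`, `0 ≤ T`, `0 < Gap` and
`Gap ≤ n/(T² + ¼) − y`, then `|∫_0^T 2(1 − cos nθ(t)) cos(ty) dt| ≤ 4/y + 2/Gap`. -/
theorem abs_integral_kernel_Ioc_le (n : ℕ) {T y Gap : ℝ} (hT : 0 ≤ T) (hy : 0 < y) (hGap : 0 < Gap)
    (hGy : Gap ≤ n / (T ^ 2 + 1 / 4) - y) :
    |∫ t in (0 : ℝ)..T, 2 * (1 - Real.cos (n * liZeroAngle t)) * Real.cos (t * y)| ≤ 4 / y + 2 / Gap := by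
  set ϑ : ℝ → ℝ := fun t ↦ π - 2 * Real.arctan (2 * t) with hϑ
  -- a.e. on `Ι 0 T = Ioc 0 T` the kernel is `2cos(ty) − cos(nϑ + ty) − cos(nϑ − ty)`
  have hae : ∀ᵐ t : ℝ, t ∈ Ι (0 : ℝ) T → 2 * (1 - Real.cos (n * liZeroAngle t)) * Real.cos (t * y) =
      2 * Real.cos (t * y) - Real.cos (n * ϑ t + 1 * (t * y)) - Real.cos (n * ϑ t + (-1) * (t * y)) := by
    refine Filter.Eventually.of_forall fun t ht ↦ ?_
    rw [uIoc_of_le hT] at ht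
    rw [liZeroAngle_eq_pi_sub ht.1]
    simp only [hϑ, one_mul, neg_one_mul, ← sub_eq_add_neg]
    rw [Real.cos_add, Real.cos_sub]
    ring
  rw [intervalIntegral.integral_congr_ae hae]
  have hc0 : Continuous fun t : ℝ ↦ 2 * Real.cos (t * y) := by fun_prop
  have hc1 : Continuous fun t : ℝ ↦ Real.cos (n * ϑ t + 1 * (t * y)) := by simp only [hϑ]; fun_prop
  have hc2 : Continuous fun t : ℝ ↦ Real.cos (n * ϑ t + (-1) * (t * y)) := by simp only [hϑ]; fun_prop
  have i01 : IntervalIntegrable (fun t : ℝ ↦ 2 * Real.cos (t * y) - Real.cos (n * ϑ t + 1 * (t * y))) volume 0 T :=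
    (hc0.sub hc1).intervalIntegrable _ _
  have i0 : IntervalIntegrable (fun t : ℝ ↦ 2 * Real.cos (t * y)) volume 0 T := hc0.intervalIntegrable _ _
  have i1 : IntervalIntegrable (fun t : ℝ ↦ Real.cos (n * ϑ t + 1 * (t * y))) volume 0 T := hc1.intervalIntegrable _ _
  have i2 : IntervalIntegrable (fun t : ℝ ↦ Real.cos (n * ϑ t + (-1) * (t * y))) volume 0 T :=
    hc2.intervalIntegrable _ _
  rw [intervalIntegral.integral_sub i01 i2, intervalIntegral.integral_sub i0 i1]
  -- each cosine integral is the real part of an `e^{iφ}` integral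
  have hcos : ∀ s : ℝ, ∫ t in (0 : ℝ)..T, Real.cos (n * ϑ t + s * (t * y)) =
      (∫ t in (0 : ℝ)..T, Complex.exp (I * ((n * (π - 2 * Real.arctan (2 * t)) + s * (t * y) : ℝ) : ℂ))).re := by
    intro s
    have hi : IntervalIntegrable (fun t : ℝ ↦ Complex.exp (I * ((n * (π - 2 * Real.arctan (2 * t)) + s * (t * y) : ℝ) : ℂ)))
        volume 0 T := (Continuous.intervalIntegrable (by fun_prop) _ _)
    have hcomm := ContinuousLinearMap.intervalIntegral_comp_comm Complex.reCLM hi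
    simp only [Complex.reCLM_apply] at hcomm
    rw [← hcomm]
    refine intervalIntegral.integral_congr fun t _ ↦ ?_
    simp only [hϑ]
    rw [mul_comm I, Complex.exp_ofReal_mul_I_re]
  have hP : ‖∫ t in (0 : ℝ)..T, Complex.exp (I * ((n * (π - 2 * Real.arctan (2 * t)) + 1 * (t * y) : ℝ) : ℂ))‖ ≤ 2 / Gap := by
    refine norm_integral_phase_le n hT hGap fun t ht ↦ ?_
    have h4 : 4 * (n : ℝ) / (1 + 4 * T ^ 2) ≤ 4 * n / (1 + 4 * t ^ 2) := by
      apply div_le_div_of_nonneg_left (by positivity) (by positivity)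
      nlinarith [ht.1, ht.2]
    have hTq : 4 * (n : ℝ) / (1 + 4 * T ^ 2) = n / (T ^ 2 + 1 / 4) := by
      field_simp
      ring
    linarith
  have hM : ‖∫ t in (0 : ℝ)..T, Complex.exp (I * ((n * (π - 2 * Real.arctan (2 * t)) + (-1) * (t * y) : ℝ) : ℂ))‖ ≤ 2 / y := by
    refine norm_integral_phase_le n hT hy fun t _ ↦ ?_
    have : 0 ≤ 4 * (n : ℝ) / (1 + 4 * t ^ 2) := by positivity
    linarith
  have h0 := abs_integral_two_cos_le T hy
  rw [hcos 1, hcos (-1)]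
  calc |(∫ t in (0 : ℝ)..T, 2 * Real.cos (t * y)) -
        (∫ t in (0 : ℝ)..T, Complex.exp (I * ((n * (π - 2 * Real.arctan (2 * t)) + 1 * (t * y) : ℝ) : ℂ))).re -
        (∫ t in (0 : ℝ)..T, Complex.exp (I * ((n * (π - 2 * Real.arctan (2 * t)) + (-1) * (t * y) : ℝ) : ℂ))).re|
      ≤ |∫ t in (0 : ℝ)..T, 2 * Real.cos (t * y)| +
        |(∫ t in (0 : ℝ)..T, Complex.exp (I * ((n * (π - 2 * Real.arctan (2 * t)) + 1 * (t * y) : ℝ) : ℂ))).re| +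
        |(∫ t in (0 : ℝ)..T, Complex.exp (I * ((n * (π - 2 * Real.arctan (2 * t)) + (-1) * (t * y) : ℝ) : ℂ))).re| :=
          (abs_sub _ _).trans (add_le_add (abs_sub _ _) le_rfl)
    _ ≤ 2 / y + 2 / Gap + 2 / y :=
        add_le_add (add_le_add h0 ((Complex.abs_re_le_norm _).trans hP)) ((Complex.abs_re_le_norm _).trans hM)
    _ = 4 / y + 2 / Gap := by ring

/-! ### The released term -/

/-- **A released prime power gives its Coffey–Laguerre term.**  For `n ≥ 1`, `m ≥ 2`, `T ≥ 1`, `0 < Gap`,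
`Gap ≤ n/(T² + ¼) − log m`:
`|Re ∫_{Ioi T} m^{−w}(2 − k_n(w)) dy − (π/m) liLaguerreOne n (log m)| ≤ m^{−1/2}(4/log m + 2/Gap + 3 + e^{n/T²})`. -/
theorem re_setIntegral_termIntegrand_released {n m : ℕ} (hn : 1 ≤ n) (hm : 2 ≤ m) {T Gap : ℝ} (hT : 1 ≤ T)
    (hGap : 0 < Gap) (hGy : Gap ≤ n / (T ^ 2 + 1 / 4) - Real.log m) :
    |(∫ y in Ioi T, termIntegrand n m y).re - π / m * liLaguerreOne n (Real.log m)| ≤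
      (m : ℝ) ^ (-(1 / 2 : ℝ)) * (4 / Real.log m + 2 / Gap + 3 + Real.exp (n / T ^ 2)) := by
  have hm0 : 0 < m := by omega
  have hT0 : 0 < T := by linarith
  have hy : 0 < Real.log m := Real.log_pos (by exact_mod_cast (show 1 < m by omega))
  have hmr : (0 : ℝ) < m := by exact_mod_cast hm0
  set K : ℝ → ℝ := fun t ↦ 2 * (1 - Real.cos (n * liZeroAngle t)) * Real.cos (t * Real.log m) with hK
  -- the shift: `∫ termIntegrand = ∫ G(½+it) + I·bot`
  have hshift := setIntegral_termIntegrand_eq n hm0 hT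
  set bot := ∫ x in (1 / 2 : ℝ)..(3 / 2 : ℝ), G n m (x + T * I) with hbot
  have hre : (∫ y in Ioi T, termIntegrand n m y).re = (m : ℝ) ^ (-(1 / 2 : ℝ)) * (∫ t in Ioi T, K t) - bot.im := by
    rw [hshift, Complex.add_re, re_setIntegral_G_half hm0 hT0.le, Complex.mul_re, Complex.I_re, Complex.I_im]
    ring
  -- `∫_{Ioi T} K = ∫_{Ioi 0} K − ∫_0^T K`
  have hKi : IntegrableOn K (Ioi 0) := integrableOn_bridgeIntegrand n (Real.log m)
  have hsplit : ∫ t in Ioi T, K t = (∫ t in Ioi 0, K t) - ∫ t in (0 : ℝ)..T, K t := by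
    have := intervalIntegral.integral_interval_add_Ioi hKi (hKi.mono_set (Ioi_subset_Ioi hT0.le))
    linarith
  have hbridge : ∫ t in Ioi 0, K t = π * (Real.exp (-(Real.log m / 2)) * liLaguerreOne n (Real.log m)) :=
    integral_bridge_eq n hn hy
  -- `m^{−1/2} e^{−log m/2} = 1/m`
  have hhalf : (m : ℝ) ^ (-(1 / 2 : ℝ)) * Real.exp (-(Real.log m / 2)) = 1 / m := by
    rw [show -(Real.log m / 2) = Real.log m * (-(1 / 2 : ℝ)) by ring, ← Real.rpow_def_of_pos hmr,
      ← Real.rpow_add hmr]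
    norm_num
    rw [Real.rpow_neg_one]
  have hmain : (m : ℝ) ^ (-(1 / 2 : ℝ)) * (∫ t in Ioi T, K t) - π / m * liLaguerreOne n (Real.log m) =
      -((m : ℝ) ^ (-(1 / 2 : ℝ)) * ∫ t in (0 : ℝ)..T, K t) := by
    rw [hsplit, hbridge]
    have : (m : ℝ) ^ (-(1 / 2 : ℝ)) * (π * (Real.exp (-(Real.log m / 2)) * liLaguerreOne n (Real.log m))) =
        π * ((m : ℝ) ^ (-(1 / 2 : ℝ)) * Real.exp (-(Real.log m / 2))) * liLaguerreOne n (Real.log m) := by ring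
    rw [mul_sub, this, hhalf]
    ring
  -- bounds
  have hP := abs_integral_kernel_Ioc_le n hT0.le hy hGap hGy
  have hB : |bot.im| ≤ (m : ℝ) ^ (-(1 / 2 : ℝ)) * (3 + Real.exp (n / T ^ 2)) :=
    (Complex.abs_im_le_norm _).trans (norm_connector_le n hm0 hT0.ne')
  have hm12 : 0 ≤ (m : ℝ) ^ (-(1 / 2 : ℝ)) := by positivity
  calc |(∫ y in Ioi T, termIntegrand n m y).re - π / m * liLaguerreOne n (Real.log m)|
      = |-((m : ℝ) ^ (-(1 / 2 : ℝ)) * ∫ t in (0 : ℝ)..T, K t) - bot.im| := by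
        rw [hre, show (m : ℝ) ^ (-(1 / 2 : ℝ)) * (∫ t in Ioi T, K t) - bot.im - π / ↑m * liLaguerreOne n (Real.log m)
          = ((m : ℝ) ^ (-(1 / 2 : ℝ)) * (∫ t in Ioi T, K t) - π / ↑m * liLaguerreOne n (Real.log m)) - bot.im by ring,
          hmain]
    _ ≤ |(m : ℝ) ^ (-(1 / 2 : ℝ)) * ∫ t in (0 : ℝ)..T, K t| + |bot.im| := by
        rw [show -((m : ℝ) ^ (-(1 / 2 : ℝ)) * ∫ t in (0 : ℝ)..T, K t) - bot.im
          = -(((m : ℝ) ^ (-(1 / 2 : ℝ)) * ∫ t in (0 : ℝ)..T, K t) + bot.im) by ring, abs_neg]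
        exact abs_add_le _ _
    _ ≤ (m : ℝ) ^ (-(1 / 2 : ℝ)) * (4 / Real.log m + 2 / Gap) + (m : ℝ) ^ (-(1 / 2 : ℝ)) * (3 + Real.exp (n / T ^ 2)) := by
        refine add_le_add ?_ hB
        rw [abs_mul, abs_of_nonneg hm12]
        exact mul_le_mul_of_nonneg_left hP hm12
    _ = (m : ℝ) ^ (-(1 / 2 : ℝ)) * (4 / Real.log m + 2 / Gap + 3 + Real.exp (n / T ^ 2)) := by ring

end PrimeTail

end Summit.RiemannHypothesis.RiemannHypothesis.Theorems.LiTheory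

end
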